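import Literature.MathematicalPhysics.QuantumFieldTheory.Balaban1983to89.B8Thm2TorusKnitEstimatesOfMajorants
import Literature.MathematicalPhysics.QuantumFieldTheory.Balaban1983to89.B9SupplySockB9P3Zd

/-!
# `Balaban1983to89.B8Eq159TorusPerOfSockB9P3` — T. Bałaban, *Spaces of regular gauge field configurations on a lattice and gauge fixing
# conditions*, Commun. Math. Phys. **99** (1985) 75–102 [Balaban1985RegularSpaces], (1.59) p. 86 ON THE TORUS: the displayed (B)-line
# `B9P3PerAt` of the M5.9 knit IS the `ℤᵈ` b9-socket `SockB9P3` read at the torus member `torusIdx` — so cell `pub-ymgap`'s N06→N05 junction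
# (`B9SupplySockB9P3Zd.sockB9P3_allLevels_of_thm33`: [4] Theorem 3.3 BY NAME ⟹ the socket at EVERY `ℤᵈ` datum) supplies it, by name

statement-level skeleton of published theorems with citation tags; proofs where landed; nothing here is a claim about the Yang–Mills mass gap

PDF held: `paper:balaban1985-cmp99-regular-spaces-gauge-fixing` (journal page = PDF page + 74); p. 86 [PDF 12] read AS AN IMAGE this session (render
`run/shared/lean/pub/pub-balaban/b2b-balaban-ref1/pages/1985-cmp99-regular-spaces-gauge-fixing/1985-cmp99-regular-spaces-gauge-fixing-p012-x2.png`);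
[4] = T. Bałaban, *Propagators for lattice gauge theories in a background field*, Commun. Math. Phys. **99** (1985) 389–434 [Balaban1985BackgroundPropagators]
Thm 3.3 p. 399 — through the tree modules `B9SupplySockB9P3Zd` ∕ `B9SupplySockB9P3ZdLetters` (their verbatim quotations).

CITATION HEADER (lean-in-tree rule).  Cell `lit-balaban`, seat `lit-balaban-r05` (gen 86; [B8] block owner — the lineage the M5.9 assembler names for the
(B)-lines, HOME∕INBOX l.14807), sub-row G-B8-T2S; design memo `lit-balaban-r05/BLINE-DESIGN-r05.md` v1.1 §3, file B-LINE A; R3 `stmt-QuantumFields-19200`,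
helper.  REUSED BY NAME: `B8Thm2TorusKnitEstimatesOfMajorants.B9P3PerAt` (t2s-1, M5.9 file A4), `B8LeafModelZd3.SockB9P3` (pub-ymgap dag-n05),
`B8Thm2TorusMember.torusIdx ∕ torusLamb` (p33), `B8Thm4TorusAt.torusLam`, `B9SupplySockB9P3Zd.sockB9P3_allLevels_of_thm33` with its binders
`DictGlob ∕ Prop6Feed ∕ InvOnSupp ∕ CurvSmall ∕ LandauKills ∕ AvgBound ∕ HolderGlob` (pub-ymgap dag-n06-b), `B9.Thm33Printed` (r06 lineage).

WHAT IS PRINTED (verbatim, p. 86 [PDF 12]).  *"Theorem 3.3 of [4] implies the bounds: |A|₍₋₁₎, |∇^η_{U₀}A|₍₋₂₎, |D^{η*}_{U₀}D^η_{U₀}A|₍₋₃₎, |Δ^η_{U₀}A|₍₋₃₎ ≦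
B₀(|J|₍₋₃₎ + |B₁|) (1.59)"*; Prop. 3 p. 87: *"where B₀, B₀(β₀) are the corresponding norms of the operators G(U₀), H(U₀), and depend on d and L only, B₀(β₀)
on β₀ also"*; p. 77: *"we admit the case where some domains Ω_j are equal to T_η"*.

WHY THIS FILE.  The endpoint of record of sub-row G-B8-T2S, `B8Thm2TorusKnitCubeCore.hThm2_of_core` (t2s-1 g5, p635808 ✓), displays two arrows: the [4]
cube data `KnitCubeCore` and the (B)-lines — `∀ m′ ≤ K − n, ∀ α₀ ≤ c_L, ∀ U₀` (`SU(2)`-valued, `P₀`-periodic, `U₀ ∈ 𝔄_{m′}(T, α₀)`),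
`B9P3PerAt L B₀ B₀β c_B9 β_H len η m′ α₀ P₀ U₀` — (1.59)'s first inequality with its Hölder member at a periodic background, in PROPOSITION 3's FRAME
(no letter of [4]).  Cell `pub-ymgap`'s N05 knit displays the SAME display as the socket `B8LeafModelZd3.SockB9P3 L B₀ B₀β cP β len η k Ω Λs Λb` over the
`ℤᵈ` data `B8LeafModelZd.ZdIdx`, and its N06→N05 junction PROVES that socket, for EVERY datum and level, from [4] Theorem 3.3 by name
(`B9.Thm33Printed`) and six operator-letter binders — print's road (1.57)–(1.58) + Thm 3.3 + the bootstrap, kernel-checked (dag-n06-b g4,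
`B9SupplySockB9P3Zd`, 2026-08-26; 36 sequel files inhabit the binders).  THIS FILE makes the identification the knit needs: at the TORUS MEMBER
`torusIdx t` (p33: `Ω_j := ℤᵈ`, `Λs m := torusLam m`, `Λb m := torusLamb m`) the socket IS the (B)-line — `B9P3PerAt … η m α₀ P U₀` follows from
`SockB9P3 … η m (fun _ ↦ univ) (fun m ↦ torusLam m) (fun m ↦ torusLamb m)` for every unitary `U₀` and every `0 < α₀ ≤ cP`, `cB ≤ cP` (§1; the periodicity
of `W`, `A′` that `B9P3PerAt` grants is simply not used) — hence from the junction's family conclusion `∀ i : ZdIdx, ∀ m ≤ i.k, SockB9P3 …` (§2), hence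
from `B9.Thm33Printed` + the six binders at the `ℤ^{d+1}` frame (§3, ★★ `b9P3PerAt_allLevels_of_thm33`: hypotheses VERBATIM those of
`sockB9P3_allLevels_of_thm33`, conclusion = the (B)-arrow of `hThm2_of_core` for every `α₀ ≤ cP`).  Consequence for the sub-row: the (B)-arrow needs NO
separate lit-balaban programme; it is the N06→N05 junction's output read at `torusIdx`, served at the radius `min(c_L, cP)` (INTERFACE NOTE for the
assembler's successor: `hThm2_of_core` produces `c_L` existentially and takes `c_B9` as an input — take `c_B9 := cP` and serve `α₀ ≤ min(c_L, cP)`).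

HONEST SCOPE.  Adapters only (β-reduction of `Ω := fun _ ↦ univ`, `Λs := torusLam`, `Λb := torusLamb`; SU ⊂ U; threshold monotonicity): NO estimate of
[B8] ∕ [4] is proved here; §3 is MODULO the junction's displayed inputs (`B9.Thm33Printed` at a genuine `ℤ^{d+1}` frame and the letter binders — cell
`pub-ymgap`'s node N06, not discharged here); the Hölder member rides on the junction's `HolderGlob` binder (dag-n06-b's HONEST CENSUS (c): not reached from
`Thm33Printed`'s typed blocks).  Count-neutral; `stub_PV3A` ∕ `stmt-QuantumFields-19200` ∕ N05 NOT discharged; nothing continuum ∕ ℝ⁴ ∕ OS ∕ mass-gap ∕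
Clay — the Yang–Mills mass gap is NOT proved by any of this (Track A conditional rung).  No `sorry`, no `def`, no `… : Prop` fact, no `instance`, no
`notation`.  NEW file; nothing landed is modified.  Seat `lit-balaban-r05` gen 86, 2026-08-28.
-/

noncomputable section

namespace Literature.MathematicalPhysics.QuantumFieldTheory.Balaban1983to89.B8Eq159TorusPerOfSockB9P3

open B7Prop1Explicit renaming Site → LSite
open B7Prop1Explicit (e)
open B7Prop2Explicit (unitaryUnits)
open scoped Matrix Matrix.Norms.L2Operator
open B7Prop2SpecialUnitary (specialUnitaryUnits specialUnitaryUnits_le_unitaryUnits)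
open B8LeafModelZd (ZdIdx)
open B8LeafModelZd3 (SockB9P3)
open B8Thm4TorusAt (torusLam)
open B8Thm2TorusMember (TorusMember torusLamb torusIdx)
open B8Thm2TorusKnitEstimatesOfMajorants (B9P3PerAt)
open B9SupplySockB9P3ZdLetters (OpsZd DictGlob Prop6Feed InvOnSupp CurvSmall LandauKills AvgBound HolderGlob)
open B9SupplySockB9P3Zd (sockB9P3_allLevels_of_thm33)

variable {d : ℕ}

/-! ## §1 At one torus datum: the socket IS the (B)-line -/

section OneDatum

variable {𝔸 : Type} [CStarAlgebra 𝔸]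

/-- ★ **THE `ℤᵈ` b9-SOCKET AT THE TORUS DATUM IS THE DISPLAYED (B)-LINE**: `SockB9P3` at `Ω := ℤ^{d+1}` (every level), `Λs := torusLam`, `Λb := torusLamb`,
spacing `η`, truncation `m`, threshold `cP` gives `B9P3PerAt … η m α₀ P U₀` for every unitary `U₀`, every `0 < α₀ ≤ cP` and every inner threshold `cB ≤ cP`
(the periodicity clauses of `B9P3PerAt` are not used). [cite: Balaban1985RegularSpaces, (1.59) p.86, Prop. 3 p.87, p.77 («Ω_j = T_η» admitted)] -/
theorem b9P3PerAt_of_sockB9P3 {L : ℕ} {B₀ B₀β cP cB β : ℝ} {len : LSite (d + 1) → ℝ} {η : ℝ} {m : ℕ} {α₀ : ℝ} {P : ℤ}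
    {U₀ : LSite (d + 1) → Fin (d + 1) → 𝔸ˣ}
    (hS : SockB9P3 (𝔸 := 𝔸) L B₀ B₀β cP β len η m (fun _ => (Set.univ : Set (LSite (d + 1))))
      (fun m' => torusLam (d := d + 1) m') (fun m' => torusLamb (d := d + 1) m'))
    (hU₀ : ∀ x κ, U₀ x κ ∈ unitaryUnits 𝔸) (hα₀ : 0 < α₀) (hα₀c : α₀ ≤ cP) (hcB : cB ≤ cP) :
    B9P3PerAt (𝔸 := 𝔸) L B₀ B₀β cB β len η m α₀ P U₀ := by
  intro α₂ hα₂ hα₂c W hWu _ hIn hInW hLan A' hA' _ h41 h0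
  exact hS α₀ α₂ hα₀ hα₀c hα₂ (hα₂c.trans hcB) U₀ W hU₀ hWu hIn hInW hLan A' hA' h41 h0

/-- The same at an `SU(N)`-valued background (the knit's currency). [cite: Balaban1985RegularSpaces, (1.59) p.86, Thm 2 p.83 (G ⊂ SU(N))] -/
theorem b9P3PerAt_of_sockB9P3_su {N : ℕ} {L : ℕ} {B₀ B₀β cP cB β : ℝ} {len : LSite (d + 1) → ℝ} {η : ℝ} {m : ℕ} {α₀ : ℝ} {P : ℤ}
    {U₀ : LSite (d + 1) → Fin (d + 1) → (Matrix (Fin N) (Fin N) ℂ)ˣ}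
    (hS : letI : CStarAlgebra (Matrix (Fin N) (Fin N) ℂ) := {}
      SockB9P3 (𝔸 := Matrix (Fin N) (Fin N) ℂ) L B₀ B₀β cP β len η m (fun _ => (Set.univ : Set (LSite (d + 1))))
        (fun m' => torusLam (d := d + 1) m') (fun m' => torusLamb (d := d + 1) m'))
    (hU₀ : ∀ x κ, U₀ x κ ∈ specialUnitaryUnits (Fin N)) (hα₀ : 0 < α₀) (hα₀c : α₀ ≤ cP) (hcB : cB ≤ cP) :
    letI : CStarAlgebra (Matrix (Fin N) (Fin N) ℂ) := {}
    B9P3PerAt (𝔸 := Matrix (Fin N) (Fin N) ℂ) L B₀ B₀β cB β len η m α₀ P U₀ :=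
  letI : CStarAlgebra (Matrix (Fin N) (Fin N) ℂ) := {}
  b9P3PerAt_of_sockB9P3 hS (fun x κ => specialUnitaryUnits_le_unitaryUnits (hU₀ x κ)) hα₀ hα₀c hcB

/-- **FROM THE TORUS MEMBER `torusIdx`**: the socket at p33's torus datum `torusIdx hL ⟨η, hη, k, hk⟩` and a level `m` is literally the socket of §1.
[cite: Balaban1985RegularSpaces, (1.59) p.86, p.77] -/
theorem b9P3PerAt_of_sockB9P3_torusIdx {L : ℕ} (hL : 1 ≤ L) {B₀ B₀β cP cB β : ℝ} {len : LSite (d + 1) → ℝ} (t : TorusMember) {m : ℕ}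
    {α₀ : ℝ} {P : ℤ} {U₀ : LSite (d + 1) → Fin (d + 1) → 𝔸ˣ}
    (hS : SockB9P3 (𝔸 := 𝔸) L B₀ B₀β cP β len (torusIdx (d := d + 1) hL t).η m (torusIdx (d := d + 1) hL t).Ω
      (torusIdx (d := d + 1) hL t).Λs (torusIdx (d := d + 1) hL t).Λb)
    (hU₀ : ∀ x κ, U₀ x κ ∈ unitaryUnits 𝔸) (hα₀ : 0 < α₀) (hα₀c : α₀ ≤ cP) (hcB : cB ≤ cP) :
    B9P3PerAt (𝔸 := 𝔸) L B₀ B₀β cB β len t.η m α₀ P U₀ :=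
  b9P3PerAt_of_sockB9P3 hS hU₀ hα₀ hα₀c hcB

end OneDatum

/-! ## §2 From the junction's family conclusion `∀ i : ZdIdx, ∀ m ≤ i.k, SockB9P3 …` to the knit's (B)-arrow -/

section Family

variable {𝔸 : Type} [CStarAlgebra 𝔸]

/-- ★ **THE N06→N05 JUNCTION's FAMILY CONCLUSION SUPPLIES THE (B)-ARROW OF THE M5.9 ENDPOINT**: if the b9-socket holds at EVERY `ℤ^{d+1}` datum and
level (the conclusion of `B9SupplySockB9P3Zd.sockB9P3_allLevels_of_thm33`), then for every spacing `η > 0`, every truncation `m`, every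
`0 < α₀ ≤ cP`, every period `P` and every unitary background `U₀`: `B9P3PerAt L B₀ B₀β cB β len η m α₀ P U₀` (`cB ≤ cP`) — the torus member is the
datum `torusIdx hL ⟨η, _, max m 1, _⟩`. [cite: Balaban1985RegularSpaces, (1.59) p.86, Prop. 3 p.87, p.77] -/
theorem b9P3PerAt_of_sockB9P3_family {L : ℕ} (hL : 1 ≤ L) {B₀ B₀β cP cB β : ℝ} {len : LSite (d + 1) → ℝ}
    (hS : ∀ (i : ZdIdx (d + 1) L) (m : ℕ), m ≤ i.k → SockB9P3 (𝔸 := 𝔸) L B₀ B₀β cP β len i.η m i.Ω i.Λs i.Λb)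
    (hcB : cB ≤ cP) {η : ℝ} (hη : 0 < η) (m : ℕ) {α₀ : ℝ} (hα₀ : 0 < α₀) (hα₀c : α₀ ≤ cP) (P : ℤ)
    {U₀ : LSite (d + 1) → Fin (d + 1) → 𝔸ˣ} (hU₀ : ∀ x κ, U₀ x κ ∈ unitaryUnits 𝔸) :
    B9P3PerAt (𝔸 := 𝔸) L B₀ B₀β cB β len η m α₀ P U₀ :=
  b9P3PerAt_of_sockB9P3_torusIdx hL ⟨η, hη, max m 1, le_max_right _ _⟩
    (hS (torusIdx (d := d + 1) hL ⟨η, hη, max m 1, le_max_right _ _⟩) m (le_max_left _ _)) hU₀ hα₀ hα₀c hcB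

/-- The same in the EXACT binder shape of the (B)-arrow of `B8Thm2TorusKnitCubeCore.hThm2_of_core` ∕ `thm2SetupSUAt_catalogued_exists_of_core` (all
truncations `m′ ≤ k`, radius `cL ≤ cP`, `SU(N)`-valued `P`-periodic backgrounds in `𝔄_{m′}` — the periodicity and `𝔄` clauses are granted, not used).
[cite: Balaban1985RegularSpaces, (1.59) p.86, Thm 2 p.83] -/
theorem b9Arrow_of_sockB9P3_family {N : ℕ} {L : ℕ} (hL : 1 ≤ L) {B₀ B₀β cP cB cL β : ℝ} {len : LSite (d + 1) → ℝ}
    (hS : letI : CStarAlgebra (Matrix (Fin N) (Fin N) ℂ) := {}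
      ∀ (i : ZdIdx (d + 1) L) (m : ℕ), m ≤ i.k →
        SockB9P3 (𝔸 := Matrix (Fin N) (Fin N) ℂ) L B₀ B₀β cP β len i.η m i.Ω i.Λs i.Λb)
    (hcB : cB ≤ cP) (hcL : cL ≤ cP) {η : ℝ} (hη : 0 < η) (k : ℕ) (P : ℤ) :
    letI : CStarAlgebra (Matrix (Fin N) (Fin N) ℂ) := {}
    ∀ m', m' ≤ k → ∀ ⦃α₀ : ℝ⦄, 0 < α₀ → α₀ ≤ cL → ∀ U₀ : LSite (d + 1) → Fin (d + 1) → (Matrix (Fin N) (Fin N) ℂ)ˣ,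
      (∀ x κ, U₀ x κ ∈ specialUnitaryUnits (Fin N)) →
      (∀ (x : LSite (d + 1)) (μ : Fin (d + 1)), U₀ (x + P • e μ) = U₀ x) →
      B8Ineq132.InAk L m' η α₀ (fun _ => (Set.univ : Set (LSite (d + 1)))) U₀ →
      B9P3PerAt (𝔸 := Matrix (Fin N) (Fin N) ℂ) L B₀ B₀β cB β len η m' α₀ P U₀ := by
  letI : CStarAlgebra (Matrix (Fin N) (Fin N) ℂ) := {}
  intro m' _ α₀ hα₀ hα₀c U₀ hU₀ _ _
  exact b9P3PerAt_of_sockB9P3_family hL hS hcB hη m' hα₀ (hα₀c.trans hcL) P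
    (fun x κ => specialUnitaryUnits_le_unitaryUnits (hU₀ x κ))

end Family

/-! ## §3 ★★ From [4] Theorem 3.3 BY NAME at the `ℤ^{d+1}` frame: the junction composed with §2 -/

section FromThm33

variable {𝔸 : Type} [CStarAlgebra 𝔸] [Nontrivial 𝔸]

variable {I : Type} (geo : I → B9.Geometry) (bg : I → B9.Backgrounds) (GA : ∀ i, B9.KernelFamily (geo i) (bg i))
variable (L : ℕ) (mem : ℝ → ZdIdx (d + 1) L → ℕ → I)
variable (ιCfg : ∀ (M : ℝ) (i : ZdIdx (d + 1) L) (m : ℕ) (U₀ : LSite (d + 1) → Fin (d + 1) → 𝔸ˣ),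
  (∀ x κ, U₀ x κ ∈ unitaryUnits 𝔸) → (bg (mem M i m)).Cfg)
variable (ιLoc : ∀ (M : ℝ) (i : ZdIdx (d + 1) L) (m : ℕ), (LSite (d + 1) → Fin (d + 1) → 𝔸) → (geo (mem M i m)).Loc)
variable (ops : ℝ → ZdIdx (d + 1) L → ℕ → OpsZd (d + 1) 𝔸)

/-- ★★ **[4] THEOREM 3.3 (BY NAME) SUPPLIES THE DISPLAYED (B)-LINES OF THE TORUS KNIT**: under EXACTLY the hypotheses of cell `pub-ymgap`'s junction
`B9SupplySockB9P3Zd.sockB9P3_allLevels_of_thm33` at dimension `d + 1` — `B9.Thm33Printed c35 geo bg Gp GA` over a [B9] frame carrying the `ℤ^{d+1}` member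
readings (`DictGlob`), Prop. 6 in [4]'s shape (`Prop6Feed`), the operator-letter binders (3.27) `InvOnSupp`, (3.69) `CurvSmall`, (1.38)∕(3.21)
`LandauKills`, (1.56) `AvgBound`, Prop. 3's «B₀(β₀) the norm of G(U₀)» `HolderGlob` — there are `B₀ > 0`, `B₀β ≥ 0`, `cP > 0` with
`B9P3PerAt L B₀ B₀β cP β len η m α₀ P U₀` for EVERY spacing `η > 0`, truncation `m`, `0 < α₀ ≤ cP`, period `P` and unitary background `U₀`.
[cite: Balaban1985RegularSpaces, (1.57)–(1.59) p.86, Prop. 3 p.87; Balaban1985BackgroundPropagators, Thm 3.3 p.399, (3.26)–(3.27) p.395, (3.47) p.398, (3.69) p.404] -/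
theorem b9P3PerAt_allLevels_of_thm33 (hd : 1 ≤ d) (hL : 1 ≤ L) {c35 c₆ K₆ M₃ a₃ c69 q CH β : ℝ} {len : LSite (d + 1) → ℝ}
    {Gp : ∀ i, B9.KernelFamily (geo i) (bg i)} (h33 : B9.Thm33Printed c35 geo bg Gp GA)
    (hdict : DictGlob geo bg GA L mem ιCfg ιLoc ops) (hP6 : Prop6Feed bg L mem ιCfg c35 M₃ c₆ K₆)
    (hinv : InvOnSupp bg L mem ιCfg ops c35 M₃ a₃) (hcurv : CurvSmall bg L mem ιCfg ops c35 M₃ a₃ c69)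
    (hlan : LandauKills bg L mem ιCfg ops c35 M₃ a₃) (havg : AvgBound L ops q)
    (hhol : HolderGlob geo bg GA L mem ιCfg ops β len CH)
    (hc₆ : 0 < c₆) (hK₆ : 0 < K₆) (ha₃ : 0 < a₃) (hc69 : 0 ≤ c69) (hq : 0 ≤ q) :
    ∃ B₀ B₀β cP : ℝ, 0 < B₀ ∧ 0 ≤ B₀β ∧ 0 < cP ∧
      ∀ ⦃η : ℝ⦄, 0 < η → ∀ (m : ℕ) ⦃α₀ : ℝ⦄, 0 < α₀ → α₀ ≤ cP → ∀ (P : ℤ) (U₀ : LSite (d + 1) → Fin (d + 1) → 𝔸ˣ),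
        (∀ x κ, U₀ x κ ∈ unitaryUnits 𝔸) → B9P3PerAt (𝔸 := 𝔸) L B₀ B₀β cP β len η m α₀ P U₀ := by
  have hd2 : 2 ≤ d + 1 := by omega
  obtain ⟨B₀, B₀β, cP, hB₀, hB₀β, hcP, hS⟩ :=
    sockB9P3_allLevels_of_thm33 geo bg GA L mem ιCfg ιLoc ops hd2 hL h33 hdict hP6 hinv hcurv hlan havg hhol hc₆ hK₆ ha₃ hc69 hq
  exact ⟨B₀, B₀β, cP, hB₀, hB₀β, hcP, fun η hη m α₀ hα₀ hα₀c P U₀ hU₀ =>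
    b9P3PerAt_of_sockB9P3_family hL hS le_rfl hη m hα₀ hα₀c P hU₀⟩

end FromThm33

end Literature.MathematicalPhysics.QuantumFieldTheory.Balaban1983to89.B8Eq159TorusPerOfSockB9P3

end
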